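import Summits.Ventures.PercRepro.Night2NonFatGeneric

/-!
# night-2: the NON-FAT case of (FAIR) — every point of `W` on at most one active hyperplane, `N ≥ 7` (gen 37)

THE ONE-HYPERPLANE REGIME: every point of `W = G ∖ Q` lies on the hyperplane `cl (Q.erase w)` of at most one active face `w`.
Write `t_w = |W ∩ cl (Q.erase w)|`; then `Σ_{w active} t_w ≤ N` (double counting), an active face misses `≥ N + 1 − t_w` points
of `G` (`card_sdiff_clF_erase_ge`) and `t_w ≤ N − 2` (no fat closure).  The face weight is convex in `t`, so it lies below the chord
from `(0, 0)` to `(N − 2, 1/9)`: **`phiM_le_chord`**: `phiM (N + 1 − t) ≤ (1/9) · t / (N − 2)` for `N ≥ 7`, `t ≤ N − 2`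
(`54 (u − t)(11u + 10t − 50) ≥ 0`, `u = N − 2 ≥ 5`).  At a level-1 target `L1 ≤ 7/30` (one request at most), so
`vCap ≥ 11/18 − 7/30 = 17/45`, and `faceSum (Q ∪ {y}) ≤ (2/9) · N/(N − 2) + 20/9` (the faces of `Q` by the chord, at most ten faces
through `y` at `2/9`); the `N` level-1 terms sum to `≥ (17/5) · N (N − 2)/(22 N − 40) ≥ 1` for `N ≥ 7`
(`17 N² − 144 N + 200 ≥ 0`).  **`basis_pair_fair_of_at_most_one_hyperplane`** (for `N ≥ 18` the pair is never lossy; `N ≤ 6` is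
not covered — there the faces through `y` need their own hyperplane sizes).
Paper: proofs/NIGHT-2-g37.md §5.
-/

namespace PercRepro.Shadow

open PercRepro.ThmH PercRepro.PerFlat

variable {α : Type*} [DecidableEq α] {M : Matroid α} [M.Finite] {G : Finset α}

/-- The face `Q.erase w` misses `w` and the points of `W` off its hyperplane: `|G ∖ cl (Q.erase w)| ≥ N + 1 − t_w`. -/
theorem card_sdiff_clF_erase_ge (hG : G ∈ flatsQ M (5 + 1)) (hd : (gr M \ G).card = 2)
    (hk : kColoops M G = 1) {B : Finset α} (hB : B ∈ thinMembers M 5 G) (hnP : ¬ bigP M G B) {z : α}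
    (hz : z ∈ G \ clF M B) {w : α} (hw : w ∈ insert z B \ coloops M G) :
    (G \ insert z B).card + 1 ≤ (G \ clF M ((insert z B).erase w)).card +
      ((G \ insert z B).filter (fun y => y ∈ clF M ((insert z B).erase w))).card := by
  have hGg : G ⊆ gr M := (mem_flatsQ.1 hG).1
  have hQG : insert z B ⊆ G := Finset.insert_subset (Finset.mem_sdiff.1 hz).1 (subset_G_of_mem_thinMembers hB)
  have hwQ : w ∈ insert z B := (Finset.mem_sdiff.1 hw).1
  have hwcl : w ∉ clF M ((insert z B).erase w) := notMem_clF_erase_of_mem hG hd hk hB hnP hz hwQ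
  have hsub : insert w ((G \ insert z B).filter (fun y => y ∉ clF M ((insert z B).erase w))) ⊆
      G \ clF M ((insert z B).erase w) := by
    apply Finset.insert_subset (Finset.mem_sdiff.2 ⟨hQG hwQ, hwcl⟩)
    intro y hy
    rw [Finset.mem_filter] at hy
    exact Finset.mem_sdiff.2 ⟨(Finset.mem_sdiff.1 hy.1).1, hy.2⟩
  have h1 := Finset.card_le_card hsub
  rw [Finset.card_insert_of_notMem (fun h => (Finset.mem_sdiff.1 (Finset.mem_filter.1 h).1).2 hwQ)] at h1
  have h2 := Finset.card_filter_add_card_filter_not (s := G \ insert z B)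
    (fun y => y ∈ clF M ((insert z B).erase w))
  omega

/-- With no fat closure an active face has `t_w ≤ N − 2`. -/
theorem card_filter_clF_erase_le (hG : G ∈ flatsQ M (5 + 1)) (hd : (gr M \ G).card = 2)
    (hk : kColoops M G = 1) (hnf : fatClosures M 5 G 2 = ∅) {B : Finset α} (hB : B ∈ thinMembers M 5 G)
    (hnP : ¬ bigP M G B) {z : α} (hz : z ∈ G \ clF M B) {w : α} (hw : w ∈ insert z B \ coloops M G)
    (hok : faceOk M G (insert z B) w) :
    ((G \ insert z B).filter (fun y => y ∈ clF M ((insert z B).erase w))).card + 2 ≤ (G \ insert z B).card := by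
  have h1 := card_sdiff_clF_erase_ge hG hd hk hB hnP hz hw
  have h3 := three_le_card_sdiff_of_nonfat hnf hok.1
  have hQG : insert z B ⊆ G := Finset.insert_subset (Finset.mem_sdiff.1 hz).1 (subset_G_of_mem_thinMembers hB)
  -- `G ∖ cl (Q.erase w) ⊆ {w} ∪ (W ∖ cl (Q.erase w))`
  have hsub : G \ clF M ((insert z B).erase w) ⊆
      insert w ((G \ insert z B).filter (fun y => y ∉ clF M ((insert z B).erase w))) := by
    intro e he
    rw [Finset.mem_sdiff] at he
    rw [Finset.mem_insert, Finset.mem_filter, Finset.mem_sdiff]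
    by_cases hew : e = w
    · exact Or.inl hew
    · right
      refine ⟨⟨he.1, fun heQ => he.2 ?_⟩, he.2⟩
      exact subset_clF_of_subset_gr ((Finset.erase_subset _ _).trans (hQG.trans (mem_flatsQ.1 hG).1))
        (Finset.mem_erase.2 ⟨hew, heQ⟩)
  have h4 := Finset.card_le_card hsub
  have h5 := Finset.card_insert_le w ((G \ insert z B).filter (fun y => y ∉ clF M ((insert z B).erase w)))
  have h6 := Finset.card_filter_add_card_filter_not (s := G \ insert z B)
    (fun y => y ∈ clF M ((insert z B).erase w))
  omega

/-- **The chord bound**: for `N ≥ 7` and `t ≤ N − 2`, `phiM (N + 1 − t) ≤ (1/9) · t / (N − 2)`. -/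
theorem phiM_le_chord {N t : ℕ} (hN : 7 ≤ N) (ht : t + 2 ≤ N) :
    phiM (N + 1 - t) ≤ 1 / 9 * (t : ℚ) / ((N : ℚ) - 2) := by
  unfold phiM phiQ
  have hN' : (7 : ℚ) ≤ (N : ℚ) := by exact_mod_cast hN
  have ht' : (t : ℚ) + 2 ≤ (N : ℚ) := by exact_mod_cast ht
  have hcast : ((N + 1 - t : ℕ) : ℚ) = (N : ℚ) + 1 - (t : ℚ) := by
    rw [Nat.cast_sub (by omega), Nat.cast_add, Nat.cast_one]
  rw [hcast]
  have ht0 : (0 : ℚ) ≤ (t : ℚ) := by positivity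
  have hpos : (0 : ℚ) < (N : ℚ) - 2 := by linarith
  have hu : (0 : ℚ) ≤ (N : ℚ) - 2 - (t : ℚ) := by linarith
  apply max_le
  · exact div_nonneg (by positivity) hpos.le
  · rw [sub_le_iff_le_add, div_le_iff₀ (by linarith)]
    rw [div_add' _ _ _ hpos.ne', div_mul_eq_mul_div, le_div_iff₀ hpos]
    nlinarith [mul_nonneg hu (by linarith : (0 : ℚ) ≤ 11 * ((N : ℚ) - 2) + 10 * (t : ℚ) - 50)]

omit [DecidableEq α] in
/-- Double counting: `Σ_{w active} t_w ≤ N` when every point of `W` lies on at most one active hyperplane. -/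
theorem sum_card_filter_le_of_one (W A : Finset α) (P : α → α → Prop) [∀ w y, Decidable (P w y)]
    (hone : ∀ y ∈ W, (A.filter (fun w => P w y)).card ≤ 1) :
    ∑ w ∈ A, (W.filter (fun y => P w y)).card ≤ W.card := by
  calc ∑ w ∈ A, (W.filter (fun y => P w y)).card = ∑ w ∈ A, ∑ y ∈ W, (if P w y then 1 else 0) := by
        apply Finset.sum_congr rfl
        intro w _
        rw [Finset.card_filter]
    _ = ∑ y ∈ W, ∑ w ∈ A, (if P w y then 1 else 0) := Finset.sum_comm
    _ = ∑ y ∈ W, (A.filter (fun w => P w y)).card := by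
        apply Finset.sum_congr rfl
        intro y _
        rw [Finset.card_filter]
    _ ≤ ∑ _y ∈ W, 1 := Finset.sum_le_sum hone
    _ = W.card := by rw [Finset.sum_const, smul_eq_mul, mul_one]

/-- **The one-hyperplane regime, `N ≥ 7`**: every point of `W` on the hyperplane of at most one active face ⇒ the fair share. -/
theorem basis_pair_fair_of_at_most_one_hyperplane (hG : G ∈ flatsQ M (5 + 1)) (hd : (gr M \ G).card = 2)
    (hk : kColoops M G = 1) (hs : ∀ e ∈ gr M, ∀ f ∈ gr M, e ≠ f → rkN M {e, f} = 2)
    (hl : ∀ e ∈ gr M, M.Indep {e}) (hnf : fatClosures M 5 G 2 = ∅) {B : Finset α}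
    (hB : B ∈ thinMembers M 5 G) (hnP : ¬ bigP M G B) {z : α} (hz : z ∈ G \ clF M B)
    (hl0 : loss M 5 G B z ≠ 0) (hN : 7 ≤ (G \ insert z B).card)
    (hone : ∀ y ∈ G \ insert z B, (((insert z B \ coloops M G).filter (fun w => faceOk M G (insert z B) w)).filter
      (fun w => y ∈ clF M ((insert z B).erase w))).card ≤ 1) :
    loss M 5 G B z ≤ rhoL M 5 G B z * lossIncomeH M 5 G (bigP M G) (dshGT2 M 5 G) B z := by
  have hfat : (fatClosures M 5 G 2).card ≤ 1 := by
    rw [hnf, Finset.card_empty]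
    exact zero_le_one
  have hd' : (gr M \ G).card ≤ 5 := by omega
  apply basis_pair_fair_of_level_one_sum hG hd hk hs hl hfat hB hnP hz hl0
  set N : ℕ := (G \ insert z B).card with hNdef
  set A : Finset α := (insert z B \ coloops M G).filter (fun w => faceOk M G (insert z B) w) with hAdef
  have hNq : (7 : ℚ) ≤ (N : ℚ) := by exact_mod_cast hN
  have hN2 : (0 : ℚ) < (N : ℚ) - 2 := by linarith
  -- the total weight of the faces of `Q`: `Σ_{w active} 2 phi_w ≤ (2/9) N/(N − 2)`
  have hsumt : ∑ w ∈ A, ((G \ insert z B).filter (fun y => y ∈ clF M ((insert z B).erase w))).card ≤ N :=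
    sum_card_filter_le_of_one (G \ insert z B) A (fun w y => y ∈ clF M ((insert z B).erase w)) hone
  have hsumt' : ∑ w ∈ A, (((G \ insert z B).filter (fun y => y ∈ clF M ((insert z B).erase w))).card : ℚ) ≤ (N : ℚ) := by
    exact_mod_cast hsumt
  have hden : (0 : ℚ) < 2 / 9 * ((N : ℚ) / ((N : ℚ) - 2)) + 2 / 9 * 10 := by positivity
  -- every level-1 term is at least `(17/45) / ((2/9) N/(N−2) + 20/9)`
  have hterm : ∀ y ∈ G \ insert z B,
      (17 / 45 : ℚ) / (2 / 9 * ((N : ℚ) / ((N : ℚ) - 2)) + 2 / 9 * 10) ≤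
        vCap M G (insert y (insert z B)) / faceSum M G (insert y (insert z B)) := by
    intro y hy
    -- the capacity: at most one request, of at most `7/30`
    have hv := vCap_insert_ge hG hd hk hs hl hB hnP hz hy
    have hL1 : ∑ w ∈ (insert z B \ coloops M G).filter
        (fun w => faceOk M G (insert z B) w ∧ y ∈ clF M ((insert z B).erase w)), req M 5 ((insert z B).erase w) ≤ 7 / 30 := by
      have hfilt : (insert z B \ coloops M G).filter
          (fun w => faceOk M G (insert z B) w ∧ y ∈ clF M ((insert z B).erase w)) =
          A.filter (fun w => y ∈ clF M ((insert z B).erase w)) := by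
        rw [hAdef, Finset.filter_filter]
      rw [hfilt]
      calc ∑ w ∈ A.filter (fun w => y ∈ clF M ((insert z B).erase w)), req M 5 ((insert z B).erase w)
          ≤ ∑ _w ∈ A.filter (fun w => y ∈ clF M ((insert z B).erase w)), (7 / 30 : ℚ) := by
            apply Finset.sum_le_sum
            intro w hw
            rw [Finset.mem_filter, hAdef, Finset.mem_filter] at hw
            exact req_le_of_nonfat hG hd hnf hw.1.2.1
        _ = ((A.filter (fun w => y ∈ clF M ((insert z B).erase w))).card : ℚ) * (7 / 30) := by
            rw [Finset.sum_const, nsmul_eq_mul]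
        _ ≤ 1 * (7 / 30) := by
            apply mul_le_mul_of_nonneg_right _ (by norm_num)
            exact_mod_cast hone y hy
        _ = 7 / 30 := by norm_num
    have hvcap : (17 / 45 : ℚ) ≤ vCap M G (insert y (insert z B)) := by linarith
    -- the face sum: the faces of `Q` by the chord, the faces through `y` by `2/9`
    have hface : faceSum M G (insert y (insert z B)) ≤ 2 / 9 * ((N : ℚ) / ((N : ℚ) - 2)) + 2 / 9 * 10 := by
      refine le_trans (faceSum_insert_le hG hd hk hnf hB hnP hz hy) ?_
      apply add_le_add
      · have hterm' : ∀ w ∈ A, phiFace M ((insert z B).erase w) *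
            (((insert y (insert z B) \ coloops M G) \ clF M ((insert z B).erase w)).card : ℚ) ≤
            2 * (1 / 9 * ((((G \ insert z B).filter (fun y => y ∈ clF M ((insert z B).erase w))).card : ℚ) /
              ((N : ℚ) - 2))) := by
          intro w hw
          rw [hAdef, Finset.mem_filter] at hw
          have ht := card_filter_clF_erase_le hG hd hk hnf hB hnP hz hw.1 hw.2
          have hm := card_sdiff_clF_erase_ge hG hd hk hB hnP hz hw.1
          have hphi : phiFace M ((insert z B).erase w) ≤
              phiM (N + 1 - ((G \ insert z B).filter (fun y => y ∈ clF M ((insert z B).erase w))).card) :=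
            phiFace_le_of_le hG hd hw.2.1 (by omega)
          have hchord := phiM_le_chord hN ht
          have hc := card_sdiff_clF_erase_le_two hG hB hz y (Finset.mem_sdiff.1 hw.1).1
          have hc' : (((insert y (insert z B) \ coloops M G) \ clF M ((insert z B).erase w)).card : ℚ) ≤ 2 := by
            have : ((insert y (insert z B) \ coloops M G) \ clF M ((insert z B).erase w)).card ≤ 2 := by
              refine le_trans hc ?_
              split_ifs <;> norm_num
            exact_mod_cast this
          have hnn : (0 : ℚ) ≤ 1 / 9 * ((((G \ insert z B).filter (fun y => y ∈ clF M ((insert z B).erase w))).card : ℚ) /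
              ((N : ℚ) - 2)) := by positivity
          calc phiFace M ((insert z B).erase w) *
                (((insert y (insert z B) \ coloops M G) \ clF M ((insert z B).erase w)).card : ℚ)
              ≤ (1 / 9 * ((((G \ insert z B).filter (fun y => y ∈ clF M ((insert z B).erase w))).card : ℚ) /
                  ((N : ℚ) - 2))) * 2 := by
                apply mul_le_mul _ hc' (by positivity) hnn
                refine le_trans hphi ?_
                rw [mul_div_assoc] at hchord
                exact hchord
            _ = 2 * (1 / 9 * ((((G \ insert z B).filter (fun y => y ∈ clF M ((insert z B).erase w))).card : ℚ) /
                  ((N : ℚ) - 2))) := by ring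
        calc ∑ w ∈ A, phiFace M ((insert z B).erase w) *
              (((insert y (insert z B) \ coloops M G) \ clF M ((insert z B).erase w)).card : ℚ)
            ≤ ∑ w ∈ A, 2 * (1 / 9 * ((((G \ insert z B).filter (fun y => y ∈ clF M ((insert z B).erase w))).card : ℚ) /
                ((N : ℚ) - 2))) := Finset.sum_le_sum hterm'
          _ = 2 / 9 * (∑ w ∈ A, (((G \ insert z B).filter (fun y => y ∈ clF M ((insert z B).erase w))).card : ℚ)) /
                ((N : ℚ) - 2) := by
              rw [Finset.mul_sum, Finset.sum_div]
              apply Finset.sum_congr rfl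
              intro w _
              ring
          _ ≤ 2 / 9 * (N : ℚ) / ((N : ℚ) - 2) := by
              apply div_le_div_of_nonneg_right _ hN2.le
              apply mul_le_mul_of_nonneg_left hsumt' (by norm_num)
          _ = 2 / 9 * ((N : ℚ) / ((N : ℚ) - 2)) := by ring
      · apply mul_le_mul_of_nonneg_left _ (by norm_num)
        exact_mod_cast card_facesIn_mem_le_ten hG hd hk hB hnP hz hy
    have hpos := faceSum_pos_of_mem_tgtSets hG hd hk hB hnP hz hl0
      (level_one_targets_subset hG hB hz (Finset.mem_image.2 ⟨y, hy, rfl⟩))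
    rw [div_le_div_iff₀ hden hpos]
    nlinarith [vCap_nonneg (M := M) (G := G) (insert y (insert z B))]
  -- the `N` terms sum to `≥ 1`: `(17/5) N (N − 2) / (22 N − 40) ≥ 1` for `N ≥ 7`
  have hbound : (1 : ℚ) ≤ (N : ℚ) * ((17 / 45 : ℚ) / (2 / 9 * ((N : ℚ) / ((N : ℚ) - 2)) + 2 / 9 * 10)) := by
    have heq : 2 / 9 * ((N : ℚ) / ((N : ℚ) - 2)) + 2 / 9 * 10 = (22 * (N : ℚ) - 40) / (9 * ((N : ℚ) - 2)) := by
      field_simp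
      ring
    rw [heq, div_div_eq_mul_div, ← mul_div_assoc, le_div_iff₀ (by linarith)]
    nlinarith
  calc (1 : ℚ) ≤ (N : ℚ) * ((17 / 45 : ℚ) / (2 / 9 * ((N : ℚ) / ((N : ℚ) - 2)) + 2 / 9 * 10)) := hbound
    _ = ∑ _y ∈ G \ insert z B, (17 / 45 : ℚ) / (2 / 9 * ((N : ℚ) / ((N : ℚ) - 2)) + 2 / 9 * 10) := by
        rw [Finset.sum_const, nsmul_eq_mul]
    _ ≤ ∑ y ∈ G \ insert z B, vCap M G (insert y (insert z B)) / faceSum M G (insert y (insert z B)) :=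
        Finset.sum_le_sum hterm

end PercRepro.Shadow
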